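import Summits.QuantumFields.YangMills.Theses.ForcedResponseSkewness
import Summits.QuantumFields.YangMills.Theorems.ForcedResponseSkewnessResponseLocalisationDefs
import Summits.QuantumFields.YangMills.Theorems.ForcedResponseSkewnessResponseLocalisationStubSplit
import Summits.QuantumFields.YangMills.Theorems.ForcedResponseSkewnessResponseLocalisationStubShell

/-!
# Birth skeleton (BC3) for the REPAIRED `ForcedResponseSkewness.ResponseLocalisation` (gen-2 restate: shrinking supports +
relative tolerance, lead caveats R1/R2) — seat ym-idea-3 g2; registered by the lead ym-line-frs-p1 with the two
provable-now stubs already LANDED (imported below), so the registered stubs are `stub_contact` (XL) and `stub_far` (L).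

Reuses VERBATIM the landed vocabulary of `Theorems/ForcedResponseSkewnessResponseLocalisationDefs.lean` (namespace
`…Cruxes.ResponseLocalisation.Birth`: `respM`, `SplitSig`, `ShellSig` — unchanged by the repair; the lead's proofs of `stub_split` /
`stub_shell` transfer verbatim) and RE-CUTS the two ceilings for sources `v ⊆ closedBall p ρ`, `∫|v| ≤ 1`, tolerance `η·(1 + |∂_cQ2|)`:
`stub_contact` (contact + inside-support ceiling, the `∃ ρ` is ITS output — hardest, XL) and `stub_far` (far-field ceiling, L).
Composition `ResponseLocalisation_of` kernel-checked (plateau function between the δ-collar and radius D, as before).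
-/

namespace Summit.QuantumFields.YangMills.Cruxes.ResponseLocalisation.Repair

open MeasureTheory Filter Topology
open Literature.MathematicalPhysics.QuantumFieldTheory Literature.MathematicalPhysics.QuantumLattice
open Literature.Probability.LatticeModels
open Summit.QuantumFields.YangMills.Cruxes.OSLegsFromFemtoAndGap.DlrCollarTransfer
open Summit.QuantumFields.YangMills.Cruxes.ResponseLocalisation.Birth

/-! Stub statements: `SplitSig`, `ShellSig` (landed, rev 0) and the re-cut `ContactSigR`, `FarSigR` (rev 3), all in
`Theorems/ForcedResponseSkewnessResponseLocalisationDefs.lean`. -/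

-- `stub_split : SplitSig` is LANDED: the lead's `Birth.stub_split` (p589535, `Theorems/…ResponseLocalisationStubSplit.lean`).
-- `stub_shell : ShellSig` is LANDED: the lead's `Birth.stub_shell` (p589598, `Theorems/…ResponseLocalisationStubShell.lean`).

theorem stub_contact : ContactSigR := by
  sorry

theorem stub_far : FarSigR := by
  sorry

set_option maxHeartbeats 800000

/-- COMPOSITION (kernel-checked, no sorry): `ρ` from the contact stub; for a given source, `δ` from the contact stub, `D` from the
far stub, the plateau function `f` (1 on the shell `δ ≤ dist(·,K)`, `‖·‖ ≤ max D 2δ`) from `stub_shell`; `stub_split` turns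
`∂_cQ2 − Q3(f)` into `Σ_x (1 − f) respM`, whose summand vanishes on the shell and is dominated by the two indicators. -/
theorem ResponseLocalisation_holds :
    Summit.QuantumFields.YangMills.Theses.ForcedResponseSkewness.ResponseLocalisation := by
  have hsplit : SplitSig := Birth.stub_split
  have hshell : ShellSig := Birth.stub_shell
  have hcontact : ContactSigR := stub_contact
  have hfar : FarSigR := stub_far
  intro G _ _ _ _ hG
  letI : MeasurableSpace G := borel G
  haveI : BorelSpace G := ⟨rfl⟩
  intro r a hpos hlim p ε hε η hη Λ hΛ
  obtain ⟨ρ, hρ, hC⟩ := hcontact G hG r a hpos hlim p ε hε (η / 2) (by positivity) Λ hΛ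
  refine ⟨ρ, hρ, ?_⟩
  intro v hball hsupp hL1 hfloor
  obtain ⟨δ, hδ, β₁, Λ₁, hC⟩ := hC v hball hsupp hL1 hfloor
  obtain ⟨D₀, hD₀, β₂, Λ₂, hF⟩ := hfar G hG r a hpos hlim p ρ ε hε v hball hsupp hL1 hfloor (η / 2) (by positivity) Λ hΛ
  have hδD : δ < max D₀ (2 * δ) := lt_of_lt_of_le (by linarith) (le_max_right _ _)
  obtain ⟨f, hfv, hfθ, hf01, hfone⟩ := hshell v δ (max D₀ (2 * δ)) hδ hδD
  refine ⟨f, hfv, hfθ, max β₁ β₂, max Λ₁ Λ₂, ?_⟩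
  intro β hβ L hL l hl
  have hCβ := hC β (le_trans (le_max_left _ _) hβ) L (le_trans (le_max_left _ _) hL) l hl
  have hFβ := hF β (le_trans (le_max_right _ _) hβ) L (le_trans (le_max_right _ _) hL) l hl
  rw [hsplit G hG r β L (l * a β) v f]
  -- pointwise domination of the summand by the contact + far indicators
  have hpt : ∀ x ∈ box 4 L,
      |(1 - f ((l * a β) • siteToE x)) * respM G r β L (l * a β) v x| ≤
        (if Metric.infDist ((l * a β) • siteToE x) (tsupport v ∪ tsupport (thetaTest 4 v)) < δ then
            |respM G r β L (l * a β) v x| else 0) +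
          (if D₀ < ‖(l * a β) • siteToE x‖ then |respM G r β L (l * a β) v x| else 0) := by
    intro x _
    set y := (l * a β) • siteToE x with hy
    set M := respM G r β L (l * a β) v x with hM
    have h01 := hf01 y
    have habs1 : |1 - f y| ≤ 1 := by
      rw [abs_le]; constructor <;> linarith [h01.1, h01.2]
    rw [abs_mul]
    by_cases h1 : f y = 1
    · rw [h1]; simp only [sub_self, abs_zero, zero_mul]
      positivity
    · have hcase : Metric.infDist y (tsupport v ∪ tsupport (thetaTest 4 v)) < δ ∨ D₀ < ‖y‖ := by
        by_contra hcon
        rw [not_or, not_lt, not_lt] at hcon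
        have hD : ‖y‖ ≤ max D₀ (2 * δ) := le_trans hcon.2 (le_max_left _ _)
        exact h1 (hfone y hcon.1 hD)
      have hMnn : 0 ≤ |M| := abs_nonneg _
      have hle1 : |1 - f y| * |M| ≤ |M| := by
        calc |1 - f y| * |M| ≤ 1 * |M| := mul_le_mul_of_nonneg_right habs1 hMnn
          _ = |M| := one_mul _
      rcases hcase with hnear | hfar'
      · rw [if_pos hnear]
        have : 0 ≤ (if D₀ < ‖y‖ then |M| else 0) := by split_ifs <;> positivity
        linarith
      · rw [if_pos hfar']
        have : 0 ≤ (if Metric.infDist y (tsupport v ∪ tsupport (thetaTest 4 v)) < δ then |M| else 0) := by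
          split_ifs <;> positivity
        linarith
  calc |∑ x ∈ box 4 L, (1 - f ((l * a β) • siteToE x)) * respM G r β L (l * a β) v x|
      ≤ ∑ x ∈ box 4 L, |(1 - f ((l * a β) • siteToE x)) * respM G r β L (l * a β) v x| :=
        Finset.abs_sum_le_sum_abs _ _
    _ ≤ ∑ x ∈ box 4 L,
          ((if Metric.infDist ((l * a β) • siteToE x) (tsupport v ∪ tsupport (thetaTest 4 v)) < δ then
              |respM G r β L (l * a β) v x| else 0) +
            (if D₀ < ‖(l * a β) • siteToE x‖ then |respM G r β L (l * a β) v x| else 0)) :=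
        Finset.sum_le_sum hpt
    _ = (∑ x ∈ box 4 L,
          (if Metric.infDist ((l * a β) • siteToE x) (tsupport v ∪ tsupport (thetaTest 4 v)) < δ then
              |respM G r β L (l * a β) v x| else 0)) +
          ∑ x ∈ box 4 L, (if D₀ < ‖(l * a β) • siteToE x‖ then |respM G r β L (l * a β) v x| else 0) :=
        Finset.sum_add_distrib
    _ ≤ η / 2 * (1 + |deriv (fun c : ℝ => Q2 G r c L (l * a β) (thetaTest 4 v) v) β|)
          + η / 2 * (1 + |deriv (fun c : ℝ => Q2 G r c L (l * a β) (thetaTest 4 v) v) β|) := add_le_add hCβ hFβ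
    _ = η * (1 + |deriv (fun c : ℝ => Q2 G r c L (l * a β) (thetaTest 4 v) v) β|) := by ring

end Summit.QuantumFields.YangMills.Cruxes.ResponseLocalisation.Repair
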